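import Literature.NumberTheory.EllipticCurves.BigRepModuleDualShiftedEndomorphismCofiniteProofs
import Literature.NumberTheory.EllipticCurves.BigRepModuleDualShiftedEndomorphismCokernelProofs
import Literature.Algebra.Module.DVRModuleType
import Mathlib.RingTheory.PowerSeries.Binomial
import HarnessLib

/-!
# Kernel and cokernel of a shifted endomorphism `τ_c ∘ F_* − 1` of `B ⊗ Λ^*` for a COFINITELY
# GENERATED `p`-primary `B` — the divisible part `B_div`, keyed on `B` alone — PROVED

Topic `Literature/NumberTheory/EllipticCurves` (namespace = path + `BigRepModule`). THEOREMS ONLY: no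
definition, no named fact, no instance, no `sorry`. Cell `bsd-stepL` (typer lane `defn-ty1`, g10):
module L5 steps **(S2)/(S3)** of the discharge of the local atom
`JetchevSkinnerWan2017.sigmaLocal_charIdeal_eulerFactor_mem_of_noTamagawaDefect` (K2 support 20495) at a
FINITELY DECOMPOSED place in the GOOD ∕ MULTIPLICATIVE case, where the coefficient modules
`E[p^∞]^{I_w}` and `H¹(I_w, E[p^∞])` are cofinitely generated but neither finite nor cofree.

## The printed statements

[GreenbergLNM1716] §3, proof of Lemma 3.3: "The group `B_v = H⁰(K, E[p^∞])` is isomorphic to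
`(ℚ_p/ℤ_p)^e ×` (a finite group) … `(γ_{v_n} − 1)B_v` contains `(B_v)_div` … hence
`|ker(r_{v_n})| ≤ |B_v/(B_v)_div|`"; [GreenbergVatsal2000] proof of Prop. (2.4) (arXiv pp. 21–23):
"a divisible `𝒪`-module. Its Pontryagin dual is a torsion-free, finitely generated `𝒪`-module and
must therefore be free", and the characteristic ideal of `H¹((ℚ_∞)_η, A)^` is generated by
`𝓟_ℓ = P_ℓ(ℓ⁻¹γ_ℓ)`, `P_ℓ(X) = det(1 − Frob_ℓ X | …)`.

## What is proved (tree's co-induced model `L(B) = BigRepModule ℤ_[p] p B`; `E_B Φ = τ_c (F_{B*} Φ) − Φ`)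

For a `p`-primary `ℤ_p`-module `B` with finitely generated Pontryagin dual `X = B^∨`
(Mathlib `CharacterModule B`, `[Module.Finite ℤ_[p] (CharacterModule B)]`; the tree's
`module_finite_characterModule_of_torsion_finite` supplies this from `B[p]` finite), torsion submodule
`T = X_tors` and `Y = X ⧸ T` (free of finite rank):

* §1 **the divisible part** `D = T^⊥ = {b | χ b = 0 ∀ χ ∈ T}` (stated through its membership
  predicate, no new definition): `B ⧸ D` is FINITE (`finite_quotient_of_mem_iff_torsion`), `D` is
  stable under every endomorphism (`map_mem_of_mem_iff_torsion`), a character vanishing on `D` is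
  torsion (`mem_torsion_of_forall_mem_iff_torsion`), and restriction `Y = X ⧸ T → D^∨` is a Pontryagin
  DUAL DATUM for `D` (`exists_isDualPairing_of_mem_iff_torsion`: `D` is COFREE with dual `Y`);
* §2 **non-vanishing** (any domain `𝒪` with `ℤ_p ↪ 𝒪`, `c ≠ 0`): `P((1+T)^c) ≠ 0` in `𝒪⟦T⟧` for every
  nonzero `P ∈ 𝒪[X]` (`aeval_binomSeries_ne_zero`), hence `(charpoly Lt).reverse((1+T)^c) ≠ 0` and
  **`det((1+T)^c · ᵗM − 1) ≠ 0`** (`det_shiftedMatrix_ne_zero`) — the `det N ≠ 0` hypothesis of the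
  cofree theorems (`BigRepModuleDualShiftedEndomorphismCharIdealProofs` etc.) is automatic;
* §3 **the kernel**: for `F_B : B → B`, `Lt` the endomorphism of `Y` induced by `F_B^∨`
  (`Lt [χ] = [χ ∘ F_B]`; it exists, `exists_quotientTorsion_endo_dual`) and `c ≠ 0`: `(ker E_B)^∨` is
  a finitely generated torsion `Λ`-module with **`Ch_Λ((ker E_B)^∨) = (P((1+T)^c))`,
  `P = (charpoly Lt).reverse`** (`finite_isTorsion_charIdeal_characterModule_ker_shiftedEndo_eq_span_aeval`,
  membership form `aeval_reverse_charpoly_mem_charIdeal_characterModule_ker_shiftedEndo`; basis form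
  `…_of_moduleFinite` with `Ch = (det N)`, `N = (1+T)^c · ᵗM − 1`, `ᵗM = (toMatrix b b Lt).map C`);
* §4 **the cokernel**: under the same hypotheses `L(B) ⧸ E_B(L(B))` is FINITE
  (`finite_quotient_range_shiftedEndo_of_moduleFinite`).
* §5 **any free dual datum computes `charpoly Lt`** (cofree `B` with `Greenberg2016.IsDualPairing`
  datum `(Y₀, tD₀)`, adjoint `Lt₀`): `charpoly Lt = charpoly Lt₀`
  (`charpoly_quotientTorsion_endo_dual_eq_of_isDualPairing`), hence
  `Ch_Λ((ker E_B)^∨) = ((charpoly Lt₀).reverse((1+T)^c))`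
  (`finite_isTorsion_charIdeal_characterModule_ker_shiftedEndo_of_isDualPairing`, membership and
  cokernel forms) — the lattice on which `det(1 − X·Frob)` is computed is the consumer's choice.

§3–§4 are the tree's `…_of_exact` theorems (`BigRepModuleDualShiftedEndomorphismCofiniteProofs`,
`…CokernelProofs`) applied to `0 → D → B → B ⧸ D → 0`, with §2 discharging `det N ≠ 0`.

HONEST FRAMING: pure `ℤ_p`/`Λ`-module algebra; nothing about Galois cohomology or BSD is proved here
and the named local fact is NOT discharged by this file.

References: [GreenbergLNM1716] §3 (proof of Lemma 3.3); [GreenbergVatsal2000] Prop. 2.4 and proof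
(arXiv pp. 21–23); [PollackWeston2011] Lemma 3.2.
-/

noncomputable section

open Literature.NumberTheory.IwasawaTheory.Greenberg2016

namespace Literature.NumberTheory.EllipticCurves.BigRepModule

/-! ## §1 The divisible part of a cofinitely generated `ℤ_p`-module -/

section DivisiblePart

-- `B : Type` (universe 0): the tree's dual-datum predicate `Greenberg2016.IsDualPairing ℤ_[p] D tD`
-- forces `D` into the universe of `ℤ_[p]`.
variable {p : ℕ} [Fact p.Prime] {B : Type} [AddCommGroup B] [Module ℤ_[p] B]

/-- A finitely generated torsion `ℤ_p`-module is finite (`≅ Π ℤ/p^{nᵢ}`, tree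
`exists_addEquiv_pi_zmod_pow_padicInt_of_isTorsion`).
[cite: GreenbergLNM1716, §3, proof of Lemma 3.3 (B_v ≅ (ℚ_p/ℤ_p)^e × (a finite group))] -/
theorem finite_of_module_finite_of_isTorsion_padicInt (M : Type*) [AddCommGroup M] [Module ℤ_[p] M]
    [Module.Finite ℤ_[p] M] (hM : Module.IsTorsion ℤ_[p] M) : Finite M := by
  obtain ⟨s, n, hn, -, ⟨e⟩⟩ :=
    Literature.Algebra.Module.exists_addEquiv_pi_zmod_pow_padicInt_of_isTorsion (p := p) M hM
  haveI : ∀ i, NeZero (p ^ n i) := fun i => ⟨pow_ne_zero _ (Fact.out : p.Prime).ne_zero⟩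
  exact Finite.of_equiv _ e.symm.toEquiv

/-- The torsion submodule of a finitely generated `ℤ_p`-module (here: of the Pontryagin dual of a
cofinitely generated `B`) is finite.
[cite: GreenbergLNM1716, §3, proof of Lemma 3.3 (B_v ≅ (ℚ_p/ℤ_p)^e × (a finite group))] -/
theorem finite_torsion_characterModule [Module.Finite ℤ_[p] (CharacterModule B)] :
    Finite (Submodule.torsion ℤ_[p] (CharacterModule B)) :=
  finite_of_module_finite_of_isTorsion_padicInt (p := p) _ (Submodule.torsion_isTorsion)

/-- **The divisible part, as a predicate.** There is a `ℤ_p`-submodule `D ≤ B` consisting exactly of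
the elements killed by every TORSION character: `D = (X_tors)^⊥`, `X = B^∨`. (For cofinitely
generated `B` this is the maximal divisible subgroup `B_div ≅ (ℚ_p/ℤ_p)^e`; only the membership
predicate is used below, so no definition is introduced.)
[cite: GreenbergLNM1716, §3, proof of Lemma 3.3 (B_v ≅ (ℚ_p/ℤ_p)^e × finite, (B_v)_div)] -/
theorem exists_submodule_mem_iff_torsion :
    ∃ D : Submodule ℤ_[p] B,
      ∀ b : B, b ∈ D ↔ ∀ χ ∈ Submodule.torsion ℤ_[p] (CharacterModule B), χ b = 0 :=
  ⟨{ carrier := {b | ∀ χ ∈ Submodule.torsion ℤ_[p] (CharacterModule B), χ b = 0}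
     add_mem' := fun {x y} hx hy χ hχ => by rw [map_add, hx χ hχ, hy χ hχ, add_zero]
     zero_mem' := fun χ _ => map_zero χ
     smul_mem' := fun r x hx χ hχ => by
       change χ (r • x) = 0
       rw [← CharacterModule.smul_apply]
       exact hx _ (Submodule.smul_mem _ r hχ) }, fun _ => Iff.rfl⟩

/-- The character module of a finite abelian group is finite; a private copy of the tree's
`SkinnerUrban2014.….finite_characterModule`. [folklore] -/
private theorem finite_characterModule'' (X : Type*) [AddCommGroup X] [Finite X] :
    Finite (CharacterModule X) :=
  Literature.NumberTheory.EllipticCurves.SkinnerUrban2014.finite_characterModule X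

/-- **`B ⧸ B_div` is finite** for cofinitely generated `B`: evaluation `b ↦ (χ ↦ χ b)` embeds
`B ⧸ D` into the (finite) character group of the finite torsion submodule `X_tors`.
[cite: GreenbergLNM1716, §3, proof of Lemma 3.3 (|B_v/(B_v)_div| finite)] -/
theorem finite_quotient_of_mem_iff_torsion [Module.Finite ℤ_[p] (CharacterModule B)]
    (D : Submodule ℤ_[p] B)
    (hD : ∀ b : B, b ∈ D ↔ ∀ χ ∈ Submodule.torsion ℤ_[p] (CharacterModule B), χ b = 0) :
    Finite (B ⧸ D) := by
  haveI := finite_torsion_characterModule (p := p) (B := B)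
  haveI : Finite (CharacterModule (Submodule.torsion ℤ_[p] (CharacterModule B))) :=
    finite_characterModule'' _
  -- evaluation `B → (X_tors)^∨`
  let ev : B →ₗ[ℤ_[p]] CharacterModule (Submodule.torsion ℤ_[p] (CharacterModule B)) :=
    { toFun := fun b =>
        { toFun := fun χ => (χ : CharacterModule B) b
          map_zero' := rfl
          map_add' := fun _ _ => rfl }
      map_add' := fun x y => by
        ext χ
        exact map_add (χ : CharacterModule B) x y
      map_smul' := fun r x => by
        ext χ
        rfl }
  have hker : ∀ b : B, ev b = 0 ↔ b ∈ D := by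
    intro b
    rw [hD]
    constructor
    · intro h χ hχ
      exact DFunLike.congr_fun h ⟨χ, hχ⟩
    · intro h
      ext χ
      exact h χ χ.2
  have hle : D ≤ LinearMap.ker ev := fun b hb => (hker b).2 hb
  refine Finite.of_injective (D.liftQ ev hle) ?_
  rw [← LinearMap.ker_eq_bot]
  exact Submodule.ker_liftQ_eq_bot _ _ _ fun b hb => (hker b).1 hb

/-- **`B_div` is stable under every endomorphism** `F` of `B` (`F^∨` maps torsion characters to
torsion characters). [cite: GreenbergLNM1716, §3, proof of Lemma 3.3 ((γ − 1)B_v ⊇ (B_v)_div)] -/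
theorem map_mem_of_mem_iff_torsion (D : Submodule ℤ_[p] B)
    (hD : ∀ b : B, b ∈ D ↔ ∀ χ ∈ Submodule.torsion ℤ_[p] (CharacterModule B), χ b = 0)
    (F : B →ₗ[ℤ_[p]] B) {b : B} (hb : b ∈ D) : F b ∈ D := by
  rw [hD] at hb ⊢
  intro χ hχ
  obtain ⟨a, ha⟩ := (Submodule.mem_torsion_iff χ).1 hχ
  have hχ' : CharacterModule.dual F χ ∈ Submodule.torsion ℤ_[p] (CharacterModule B) := by
    refine (Submodule.mem_torsion_iff _).2 ⟨a, ?_⟩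
    change (a : ℤ_[p]) • CharacterModule.dual F χ = 0
    rw [← LinearMap.map_smul]
    change CharacterModule.dual F (a • χ) = 0
    rw [ha, map_zero]
  exact hb _ hχ'

/-- **A character vanishing on `B_div` is torsion**: `B ⧸ D` is finite, so `m = #(B ⧸ D)` satisfies
`m·B ⊆ D` and `m·χ = 0`. [cite: GreenbergLNM1716, §3, proof of Lemma 3.3 (|B_v/(B_v)_div| finite)] -/
theorem mem_torsion_of_forall_mem_iff_torsion [Module.Finite ℤ_[p] (CharacterModule B)]
    (D : Submodule ℤ_[p] B)
    (hD : ∀ b : B, b ∈ D ↔ ∀ χ ∈ Submodule.torsion ℤ_[p] (CharacterModule B), χ b = 0)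
    (χ : CharacterModule B) (hχ : ∀ b ∈ D, χ b = 0) :
    χ ∈ Submodule.torsion ℤ_[p] (CharacterModule B) := by
  haveI := finite_quotient_of_mem_iff_torsion D hD
  have hm : Nat.card (B ⧸ D) ≠ 0 := (Nat.card_pos (α := B ⧸ D)).ne'
  have hmB : ∀ b : B, Nat.card (B ⧸ D) • b ∈ D := fun b => by
    rw [← Submodule.Quotient.mk_eq_zero D, Submodule.Quotient.mk_smul]
    exact card_nsmul_eq_zero'
  refine (Submodule.mem_torsion_iff χ).2
    ⟨⟨(Nat.card (B ⧸ D) : ℤ_[p]), mem_nonZeroDivisors_of_ne_zero (by exact_mod_cast hm)⟩, ?_⟩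
  ext b
  change χ ((Nat.card (B ⧸ D) : ℤ_[p]) • b) = 0
  rw [Nat.cast_smul_eq_nsmul]
  exact hχ _ (hmB b)

/-- **`B_div` is COFREE with Pontryagin dual `Y = X ⧸ X_tors`**: restriction of characters
`X = B^∨ → D^∨` kills `X_tors` (definition of `D`), is onto (`ℚ/ℤ` is injective) with kernel exactly
`X_tors` (previous lemma), so it induces a DUAL DATUM `tD : X ⧸ X_tors ≅ D^∨`
(`Greenberg2016.IsDualPairing`), characterised by `tD [χ] d = χ d`; and `X ⧸ X_tors` is a finitely
generated free `ℤ_p`-module ("its Pontryagin dual is a torsion-free, finitely generated `𝒪`-module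
and must therefore be free").
[cite: GreenbergVatsal2000, proof of Prop. 2.4 ff. (arXiv p. 23: divisible ⟹ dual torsion-free f.g. ⟹ free)]
[cite: GreenbergLNM1716, §3, proof of Lemma 3.3 (B_v ≅ (ℚ_p/ℤ_p)^e × finite)] -/
theorem exists_isDualPairing_of_mem_iff_torsion [Module.Finite ℤ_[p] (CharacterModule B)]
    (D : Submodule ℤ_[p] B)
    (hD : ∀ b : B, b ∈ D ↔ ∀ χ ∈ Submodule.torsion ℤ_[p] (CharacterModule B), χ b = 0) :
    ∃ tD : (CharacterModule B ⧸ Submodule.torsion ℤ_[p] (CharacterModule B)) →+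
        (D →+ AddCircle (1 : ℚ)),
      IsDualPairing ℤ_[p] D tD ∧
        ∀ (χ : CharacterModule B) (d : D), tD (Submodule.Quotient.mk χ) d = χ d := by
  set T := Submodule.torsion ℤ_[p] (CharacterModule B) with hT
  have hle : T ≤ LinearMap.ker (CharacterModule.dual (R := ℤ_[p]) D.subtype) := by
    intro χ hχ
    rw [LinearMap.mem_ker]
    ext d
    exact ((hD d).1 d.2) χ hχ
  have hker : LinearMap.ker (CharacterModule.dual (R := ℤ_[p]) D.subtype) ≤ T := by
    intro χ hχ
    rw [LinearMap.mem_ker] at hχ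
    exact mem_torsion_of_forall_mem_iff_torsion D hD χ fun b hb => DFunLike.congr_fun hχ ⟨b, hb⟩
  refine ⟨(T.liftQ _ hle).toAddMonoidHom, ⟨⟨?_, ?_⟩, ?_⟩, fun χ d => rfl⟩
  · -- injective
    have h : Function.Injective (T.liftQ _ hle) :=
      LinearMap.ker_eq_bot.1 (Submodule.ker_liftQ_eq_bot _ _ _ hker)
    exact h
  · -- surjective: characters of `D` extend to `B`
    intro ψ
    obtain ⟨χ, hχ⟩ :=
      CharacterModule.dual_surjective_of_injective (R := ℤ_[p]) D.subtype D.injective_subtype ψ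
    exact ⟨Submodule.Quotient.mk χ, hχ⟩
  · -- balanced
    intro r y d
    obtain ⟨χ, rfl⟩ := Submodule.Quotient.mk_surjective T y
    rfl

end DivisiblePart

/-! ## §2 Non-vanishing of `P((1+T)^c)` and of `det((1+T)^c·ᵗM − 1)` for `c ≠ 0` -/

section Nonvanishing

universe u

variable {𝒪 : Type u} [CommRing 𝒪] [IsDomain 𝒪] {p : ℕ} [Fact p.Prime] [Algebra ℤ_[p] 𝒪]

omit [IsDomain 𝒪] in
/-- **Bridge to Mathlib's binomial series**: the tree's `binomSeries 𝒪 c = ∑ C(c,i) Tⁱ`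
(`Greenberg2006/CoinducedModuleDual`, coefficients `algebraMap ℤ_[p] 𝒪 (Ring.choose c i)`) IS
Mathlib's `PowerSeries.binomialSeries 𝒪 c` (coefficients `Ring.choose c i • 1`) — hence also the
value of the tree's unit `IwasawaCharacter.onePlusTPow p 𝒪 c` (`val_onePlusTPow`, by `rfl`), the
`u = (1+T)^c` of the `Σ`-Euler factors `SigmaEulerFactors.eulerFactor`.
[cite: CoatesSujatha2006Cyclotomic, Lemma 3.3.4 (§3.3 p. 37: 1_{ℤ_p} ↦ 1 + T)] -/
theorem binomSeries_eq_binomialSeries (c : ℤ_[p]) :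
    binomSeries 𝒪 c = PowerSeries.binomialSeries 𝒪 c := by
  ext n
  rw [coeff_binomSeries, PowerSeries.binomialSeries_coeff, Algebra.algebraMap_eq_smul_one]

/-- Over a domain `𝒪`: if `Q ∈ 𝒪[X]` is nonzero and `w ∈ 𝒪⟦T⟧` has nonzero constant term, then
`Q(T·w) ≠ 0` (induction on `deg Q`: either `Q(0) ≠ 0` is the constant term of `Q(T·w)`, or
`Q = X·Q₁` and `Q(T·w) = T·w·Q₁(T·w)`). Used for "`𝓟_ℓ(T)` is a nonzero element of `Λ`".
[cite: GreenbergVatsal2000, §2 (arXiv p. 9: "𝓟_ℓ(T) is a nonzero element of Λ")] -/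
theorem aeval_X_mul_ne_zero_of_constantCoeff_ne_zero {Q : Polynomial 𝒪} (hQ : Q ≠ 0)
    {w : PowerSeries 𝒪} (hw : PowerSeries.constantCoeff w ≠ 0) :
    Polynomial.aeval (PowerSeries.X * w) Q ≠ 0 := by
  induction hn : Q.natDegree using Nat.strong_induction_on generalizing Q with
  | _ n ih =>
    by_cases h0 : Q.coeff 0 = 0
    · obtain ⟨Q₁, rfl⟩ := Polynomial.X_dvd_iff.2 h0
      have hQ₁ : Q₁ ≠ 0 := fun h => hQ (by rw [h, mul_zero])
      have hw0 : w ≠ 0 := fun h => hw (by rw [h, map_zero])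
      rw [map_mul, Polynomial.aeval_X]
      refine mul_ne_zero (mul_ne_zero PowerSeries.X_ne_zero hw0) (ih Q₁.natDegree ?_ hQ₁ rfl)
      rw [← hn, Polynomial.natDegree_X_mul hQ₁]
      exact Nat.lt_succ_self _
    · intro h
      apply h0
      have h1 := congrArg PowerSeries.constantCoeff h
      rw [← Polynomial.X_mul_divX_add Q] at h1
      simp only [map_add, map_mul, Polynomial.aeval_X, Polynomial.aeval_C, PowerSeries.constantCoeff_X,
        zero_mul, zero_add, map_zero, ← PowerSeries.C_eq_algebraMap, PowerSeries.constantCoeff_C] at h1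
      exact h1

/-- **`P((1+T)^c) ≠ 0` in `𝒪⟦T⟧`** for every nonzero `P ∈ 𝒪[X]`, when `c ≠ 0` and `ℤ_p → 𝒪` is
injective (`𝒪` a domain): `(1+T)^c = 1 + T·w` with `w(0) = c ≠ 0`, and `P(1 + T·w) = Q(T·w)` with
`Q(X) = P(X+1) ≠ 0`. [cite: GreenbergVatsal2000, §2 (arXiv p. 9: "𝓟_ℓ(T) is a nonzero element of Λ")] -/
theorem aeval_binomSeries_ne_zero (hinj : Function.Injective (algebraMap ℤ_[p] 𝒪)) {c : ℤ_[p]}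
    (hc : c ≠ 0) {P : Polynomial 𝒪} (hP : P ≠ 0) :
    Polynomial.aeval (binomSeries 𝒪 c) P ≠ 0 := by
  set w : PowerSeries 𝒪 := PowerSeries.mk fun n => PowerSeries.coeff (n + 1) (binomSeries 𝒪 c)
    with hw
  have hu : binomSeries 𝒪 c = PowerSeries.X * w + 1 := by
    have h := PowerSeries.eq_X_mul_shift_add_const (binomSeries 𝒪 c)
    rwa [constantCoeff_binomSeries, map_one] at h
  have hw0 : PowerSeries.constantCoeff w ≠ 0 := by
    rw [hw, PowerSeries.constantCoeff_mk, zero_add, coeff_one_binomSeries]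
    exact fun h => hc (hinj (h.trans (map_zero _).symm))
  set Q := P.comp (Polynomial.X + Polynomial.C 1) with hQ
  have hQ0 : Q ≠ 0 := by
    intro h
    apply hP
    have hPQ : P = Q.comp (Polynomial.X - Polynomial.C 1) := by
      rw [hQ, Polynomial.comp_assoc, Polynomial.add_comp, Polynomial.X_comp, Polynomial.C_comp,
        sub_add_cancel, Polynomial.comp_X]
    rw [hPQ, h, Polynomial.zero_comp]
  have hPu : Polynomial.aeval (binomSeries 𝒪 c) P = Polynomial.aeval (PowerSeries.X * w) Q := by
    rw [hQ, Polynomial.aeval_comp, map_add, Polynomial.aeval_X, Polynomial.aeval_C, map_one, hu]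
  rw [hPu]
  exact aeval_X_mul_ne_zero_of_constantCoeff_ne_zero hQ0 hw0

/-- **`(charpoly Lt).reverse((1+T)^c) ≠ 0`** (`c ≠ 0`, `ℤ_p → 𝒪` injective, `𝒪` a domain): the
reversed characteristic polynomial has constant term `1`.
[cite: GreenbergVatsal2000, §2 (arXiv p. 9: "𝓟_ℓ(T) is a nonzero element of Λ"); Prop. 2.4 (p. 22)] -/
theorem aeval_binomSeries_reverse_charpoly_ne_zero (hinj : Function.Injective (algebraMap ℤ_[p] 𝒪))
    {c : ℤ_[p]} (hc : c ≠ 0) {Y : Type*} [AddCommGroup Y] [Module 𝒪 Y] [Module.Free 𝒪 Y]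
    [Module.Finite 𝒪 Y] (Lt : Y →ₗ[𝒪] Y) :
    Polynomial.aeval (binomSeries 𝒪 c) (LinearMap.charpoly Lt).reverse ≠ 0 := by
  refine aeval_binomSeries_ne_zero hinj hc fun h => ?_
  have h1 := Polynomial.coeff_zero_reverse (LinearMap.charpoly Lt)
  rw [h, Polynomial.coeff_zero, (LinearMap.charpoly_monic Lt).leadingCoeff] at h1
  exact zero_ne_one h1

/-- **`det((1+T)^c · ᵗM − 1) ≠ 0`** for `c ≠ 0` (`ℤ_p → 𝒪` injective, `𝒪` a domain) — the `det N ≠ 0`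
hypothesis of `finite_isTorsion_charIdeal_characterModule_ker_shiftedEndo` and its relatives is
AUTOMATIC: `det N = (−1)ⁿ · charpolyRev(ᵗM)((1+T)^c)` and `charpolyRev(ᵗM)(0) = 1`.
[cite: GreenbergVatsal2000, §2 (arXiv p. 9: "𝓟_ℓ(T) is a nonzero element of Λ"); Prop. 2.4 (p. 22)] -/
theorem det_shiftedMatrix_ne_zero (hinj : Function.Injective (algebraMap ℤ_[p] 𝒪)) {Y : Type u}
    [AddCommGroup Y] [Module 𝒪 Y] {n : ℕ} (b : Module.Basis (Fin n) 𝒪 Y) (Lt : Y →ₗ[𝒪] Y)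
    {c : ℤ_[p]} (hc : c ≠ 0) :
    (binomSeries 𝒪 c • (LinearMap.toMatrix b b Lt).map (PowerSeries.C (R := 𝒪)) - 1).det ≠ 0 := by
  rw [det_shiftedMatrix_eq_aeval_charpolyRev b Lt c]
  refine mul_ne_zero (pow_ne_zero _ (neg_ne_zero.2 one_ne_zero))
    (aeval_binomSeries_ne_zero hinj hc fun h => ?_)
  have h1 : Polynomial.eval 0 (LinearMap.toMatrix b b Lt).charpolyRev = 1 := by simp
  rw [h, Polynomial.eval_zero] at h1
  exact zero_ne_one h1

end Nonvanishing

/-! ## §3 The kernel of `τ_c ∘ F_* − 1` on `L(B)`, `B` cofinitely generated -/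

section Kernel

variable {p : ℕ} [Fact p.Prime] {B : Type} [AddCommGroup B] [Module ℤ_[p] B]

/-- The data of §1 bundled (private plumbing). [folklore] -/
private theorem exists_divisiblePart_data [Module.Finite ℤ_[p] (CharacterModule B)]
    (hB : ∀ b : B, ∃ k : ℕ, p ^ k • b = 0) (F_B : B →ₗ[ℤ_[p]] B) :
    ∃ (D : Submodule ℤ_[p] B)
      (tD : (CharacterModule B ⧸ Submodule.torsion ℤ_[p] (CharacterModule B)) →+
        (D →+ AddCircle (1 : ℚ))) (_ : ∀ x ∈ D, F_B x ∈ D),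
      Finite (B ⧸ D) ∧ IsDualPairing ℤ_[p] D tD ∧ (∀ d : D, ∃ k : ℕ, p ^ k • d = 0) ∧
        ∀ (χ : CharacterModule B) (d : D), tD (Submodule.Quotient.mk χ) d = χ d := by
  obtain ⟨D, hD⟩ := exists_submodule_mem_iff_torsion (p := p) (B := B)
  obtain ⟨tD, hY, htD⟩ := exists_isDualPairing_of_mem_iff_torsion D hD
  refine ⟨D, tD, fun x hx => map_mem_of_mem_iff_torsion D hD F_B hx,
    finite_quotient_of_mem_iff_torsion D hD, hY, fun d => ?_, htD⟩
  obtain ⟨k, hk⟩ := hB d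
  exact ⟨k, Subtype.ext (by exact_mod_cast hk)⟩

/-- `ℤ_p → ℤ_p` is injective (the `hinj` input of §2 at `𝒪 = ℤ_p`). [folklore] -/
private theorem algebraMap_padicInt_self_injective :
    Function.Injective (algebraMap ℤ_[p] ℤ_[p]) := fun a b h => by
  rwa [Algebra.algebraMap_self_apply, Algebra.algebraMap_self_apply] at h

/-- **[GreenbergVatsal2000] Prop. 2.4 / [GreenbergLNM1716] §3 for a COFINITELY GENERATED
coefficient module, keyed on `B` alone (basis form).** Let `B` be a `p`-primary `ℤ_p`-module with
finitely generated Pontryagin dual `X = B^∨`, `T = X_tors`, `Y = X ⧸ T`; `F_B : B → B` linear and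
`Lt` the endomorphism of `Y` induced by `F_B^∨` (`Lt [χ] = [χ ∘ F_B]`); `c ∈ ℤ_p`, `c ≠ 0`; `E_B`
any `Λ`-linear endomorphism of `L(B) = B ⊗ Λ^*` with `E_B Φ = τ_c (F_{B*} Φ) − Φ`; `b` any
`ℤ_p`-basis of `Y` and `N = (1+T)^c · ᵗM − 1`, `ᵗM = (toMatrix b b Lt).map C` (automatically
`det N ≠ 0`, `det_shiftedMatrix_ne_zero`). Then `(ker E_B)^∨` is a finitely generated torsion
`Λ = ℤ_p⟦T⟧`-module and **`Ch_Λ((ker E_B)^∨) = (det N)`** — the exact sequence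
`0 → B_div → B → B ⧸ B_div → 0` (`B_div` cofree with dual `Y`, quotient finite) fed to
`finite_isTorsion_charIdeal_characterModule_ker_shiftedEndo_of_exact`.
[cite: GreenbergVatsal2000, Prop. 2.4 and proof (arXiv pp. 21–23)]
[cite: GreenbergLNM1716, §3, proof of Lemma 3.3 (B_v ≅ (ℚ_p/ℤ_p)^e × finite)] -/
theorem finite_isTorsion_charIdeal_characterModule_ker_shiftedEndo_of_moduleFinite
    (hB : ∀ b : B, ∃ k : ℕ, p ^ k • b = 0) [Module.Finite ℤ_[p] (CharacterModule B)]
    (F_B : B →ₗ[ℤ_[p]] B) {n : ℕ}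
    (b : Module.Basis (Fin n) ℤ_[p]
      (CharacterModule B ⧸ Submodule.torsion ℤ_[p] (CharacterModule B)))
    (Lt : (CharacterModule B ⧸ Submodule.torsion ℤ_[p] (CharacterModule B)) →ₗ[ℤ_[p]]
      (CharacterModule B ⧸ Submodule.torsion ℤ_[p] (CharacterModule B)))
    (hLt : ∀ χ : CharacterModule B,
      Lt (Submodule.Quotient.mk χ) = Submodule.Quotient.mk (CharacterModule.dual F_B χ))
    {c : ℤ_[p]} (hc : c ≠ 0)
    (E_B : BigRepModule ℤ_[p] p B →ₗ[PowerSeries ℤ_[p]] BigRepModule ℤ_[p] p B)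
    (hE_B : ∀ Φ, E_B Φ = translate c (mapRange F_B Φ) - Φ) :
    Module.Finite (PowerSeries ℤ_[p]) (CharacterModule (LinearMap.ker E_B)) ∧
      Module.IsTorsion (PowerSeries ℤ_[p]) (CharacterModule (LinearMap.ker E_B)) ∧
        Module.charIdeal (PowerSeries ℤ_[p]) (CharacterModule (LinearMap.ker E_B)) =
          Ideal.span {(binomSeries ℤ_[p] c • (LinearMap.toMatrix b b Lt).map
            (PowerSeries.C (R := ℤ_[p])) - 1).det} := by
  classical
  obtain ⟨D, tD, hFD, hQ, hY, hDprim, htD⟩ := exists_divisiblePart_data hB F_B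
  haveI := hQ
  have hLt' : ∀ (y : CharacterModule B ⧸ Submodule.torsion ℤ_[p] (CharacterModule B)) (d : D),
      tD (Lt y) d = tD y (F_B.restrict hFD d) := by
    intro y d
    obtain ⟨χ, rfl⟩ := Submodule.Quotient.mk_surjective _ y
    rw [hLt, htD, htD]
    rfl
  exact finite_isTorsion_charIdeal_characterModule_ker_shiftedEndo_of_exact hDprim (Q := B ⧸ D)
    D.subtype D.injective_subtype D.mkQ (LinearMap.exact_subtype_mkQ D) hY b
    (F_B.restrict hFD) F_B (D.mapQ D F_B fun x hx => hFD x hx) (LinearMap.ext fun _ => rfl)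
    (Submodule.mapQ_mkQ _ _ _).symm Lt hLt' hc E_B hE_B
    (det_shiftedMatrix_ne_zero algebraMap_padicInt_self_injective b Lt hc)

/-- Membership form of the previous theorem: `det N ∈ Ch_Λ((ker E_B)^∨)`.
[cite: GreenbergVatsal2000, Prop. 2.4 and proof (arXiv pp. 21–23)] -/
theorem det_mem_charIdeal_characterModule_ker_shiftedEndo_of_moduleFinite
    (hB : ∀ b : B, ∃ k : ℕ, p ^ k • b = 0) [Module.Finite ℤ_[p] (CharacterModule B)]
    (F_B : B →ₗ[ℤ_[p]] B) {n : ℕ}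
    (b : Module.Basis (Fin n) ℤ_[p]
      (CharacterModule B ⧸ Submodule.torsion ℤ_[p] (CharacterModule B)))
    (Lt : (CharacterModule B ⧸ Submodule.torsion ℤ_[p] (CharacterModule B)) →ₗ[ℤ_[p]]
      (CharacterModule B ⧸ Submodule.torsion ℤ_[p] (CharacterModule B)))
    (hLt : ∀ χ : CharacterModule B,
      Lt (Submodule.Quotient.mk χ) = Submodule.Quotient.mk (CharacterModule.dual F_B χ))
    {c : ℤ_[p]} (hc : c ≠ 0)
    (E_B : BigRepModule ℤ_[p] p B →ₗ[PowerSeries ℤ_[p]] BigRepModule ℤ_[p] p B)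
    (hE_B : ∀ Φ, E_B Φ = translate c (mapRange F_B Φ) - Φ) :
    (binomSeries ℤ_[p] c • (LinearMap.toMatrix b b Lt).map (PowerSeries.C (R := ℤ_[p])) - 1).det ∈
      Module.charIdeal (PowerSeries ℤ_[p]) (CharacterModule (LinearMap.ker E_B)) := by
  rw [(finite_isTorsion_charIdeal_characterModule_ker_shiftedEndo_of_moduleFinite hB F_B b Lt hLt hc
    E_B hE_B).2.2]
  exact Ideal.mem_span_singleton_self _

/-- **Basis-free form: `Ch_Λ((ker E_B)^∨) = ((charpoly Lt).reverse((1+T)^c))`.** With `B`, `F_B`,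
`Lt`, `c ≠ 0`, `E_B` as above and `P = (LinearMap.charpoly Lt).reverse` — Mathlib `LinearMap.charpoly`,
`Polynomial.reverse`; the printed `P(X) = det(1 − Frob X)`, `𝓟 = P(ℓ⁻¹γ)`, once `Lt` is Frobenius on
the lattice `Y` — `(ker E_B)^∨` is finitely generated, torsion, and
**`Ch_Λ((ker E_B)^∨) = (P((1+T)^c))`** (`det N = (−1)^{rk Y} · P((1+T)^c)`, tree
`det_shiftedMatrix_eq_aeval_reverse_charpoly`; `P((1+T)^c) ≠ 0` automatically,
`aeval_binomSeries_reverse_charpoly_ne_zero`).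
[cite: GreenbergVatsal2000, Prop. 2.4 (arXiv p. 22: 𝓟_ℓ = P_ℓ(ℓ⁻¹γ_ℓ), P_ℓ(X) = det(1 − Frob_ℓ X))] -/
theorem finite_isTorsion_charIdeal_characterModule_ker_shiftedEndo_eq_span_aeval
    (hB : ∀ b : B, ∃ k : ℕ, p ^ k • b = 0) [Module.Finite ℤ_[p] (CharacterModule B)]
    (F_B : B →ₗ[ℤ_[p]] B)
    (Lt : (CharacterModule B ⧸ Submodule.torsion ℤ_[p] (CharacterModule B)) →ₗ[ℤ_[p]]
      (CharacterModule B ⧸ Submodule.torsion ℤ_[p] (CharacterModule B)))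
    (hLt : ∀ χ : CharacterModule B,
      Lt (Submodule.Quotient.mk χ) = Submodule.Quotient.mk (CharacterModule.dual F_B χ))
    {c : ℤ_[p]} (hc : c ≠ 0)
    (E_B : BigRepModule ℤ_[p] p B →ₗ[PowerSeries ℤ_[p]] BigRepModule ℤ_[p] p B)
    (hE_B : ∀ Φ, E_B Φ = translate c (mapRange F_B Φ) - Φ) :
    Module.Finite (PowerSeries ℤ_[p]) (CharacterModule (LinearMap.ker E_B)) ∧
      Module.IsTorsion (PowerSeries ℤ_[p]) (CharacterModule (LinearMap.ker E_B)) ∧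
        Module.charIdeal (PowerSeries ℤ_[p]) (CharacterModule (LinearMap.ker E_B)) =
          Ideal.span {Polynomial.aeval (binomSeries ℤ_[p] c) (LinearMap.charpoly Lt).reverse} := by
  classical
  set b := Module.finBasis ℤ_[p] (CharacterModule B ⧸ Submodule.torsion ℤ_[p] (CharacterModule B))
    with hb
  obtain ⟨h₁, h₂, h₃⟩ :=
    finite_isTorsion_charIdeal_characterModule_ker_shiftedEndo_of_moduleFinite hB F_B b Lt hLt hc E_B
      hE_B
  refine ⟨h₁, h₂, ?_⟩
  rw [h₃, det_shiftedMatrix_eq_aeval_reverse_charpoly b Lt c,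
    Ideal.span_singleton_mul_left_unit (isUnit_one.neg.pow _)]

/-- Membership form: `(charpoly Lt).reverse((1+T)^c) ∈ Ch_Λ((ker E_B)^∨)`.
[cite: GreenbergVatsal2000, Prop. 2.4 (arXiv p. 22)] -/
theorem aeval_reverse_charpoly_mem_charIdeal_characterModule_ker_shiftedEndo
    (hB : ∀ b : B, ∃ k : ℕ, p ^ k • b = 0) [Module.Finite ℤ_[p] (CharacterModule B)]
    (F_B : B →ₗ[ℤ_[p]] B)
    (Lt : (CharacterModule B ⧸ Submodule.torsion ℤ_[p] (CharacterModule B)) →ₗ[ℤ_[p]]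
      (CharacterModule B ⧸ Submodule.torsion ℤ_[p] (CharacterModule B)))
    (hLt : ∀ χ : CharacterModule B,
      Lt (Submodule.Quotient.mk χ) = Submodule.Quotient.mk (CharacterModule.dual F_B χ))
    {c : ℤ_[p]} (hc : c ≠ 0)
    (E_B : BigRepModule ℤ_[p] p B →ₗ[PowerSeries ℤ_[p]] BigRepModule ℤ_[p] p B)
    (hE_B : ∀ Φ, E_B Φ = translate c (mapRange F_B Φ) - Φ) :
    Polynomial.aeval (binomSeries ℤ_[p] c) (LinearMap.charpoly Lt).reverse ∈
      Module.charIdeal (PowerSeries ℤ_[p]) (CharacterModule (LinearMap.ker E_B)) := by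
  rw [(finite_isTorsion_charIdeal_characterModule_ker_shiftedEndo_eq_span_aeval hB F_B Lt hLt hc
    E_B hE_B).2.2]
  exact Ideal.mem_span_singleton_self _

/-- **The induced endomorphism `Lt` exists** (so the hypotheses above are satisfiable as stated): the
dual `F_B^∨` preserves `X_tors`, hence descends to `Y = X ⧸ X_tors` — the lattice on which
"Frob_ℓ acting on `A_{I_ℓ}(−1)^`" is computed.
[cite: GreenbergVatsal2000, proof of Prop. 2.4 (arXiv p. 22: eigenvalues of Frob_ℓ on the dual)] -/
theorem exists_quotientTorsion_endo_dual (F_B : B →ₗ[ℤ_[p]] B) :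
    ∃ Lt : (CharacterModule B ⧸ Submodule.torsion ℤ_[p] (CharacterModule B)) →ₗ[ℤ_[p]]
        (CharacterModule B ⧸ Submodule.torsion ℤ_[p] (CharacterModule B)),
      ∀ χ : CharacterModule B,
        Lt (Submodule.Quotient.mk χ) = Submodule.Quotient.mk (CharacterModule.dual F_B χ) := by
  have hle : Submodule.torsion ℤ_[p] (CharacterModule B) ≤
      (Submodule.torsion ℤ_[p] (CharacterModule B)).comap (CharacterModule.dual (R := ℤ_[p]) F_B) := by
    intro χ hχ
    obtain ⟨a, ha⟩ := (Submodule.mem_torsion_iff χ).1 hχ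
    refine (Submodule.mem_torsion_iff _).2 ⟨a, ?_⟩
    change (a : ℤ_[p]) • CharacterModule.dual F_B χ = 0
    rw [← LinearMap.map_smul]
    change CharacterModule.dual F_B (a • χ) = 0
    rw [ha, map_zero]
  exact ⟨(Submodule.torsion ℤ_[p] (CharacterModule B)).mapQ _ (CharacterModule.dual F_B) hle,
    fun χ => rfl⟩

end Kernel

/-! ## §4 The cokernel of `τ_c ∘ F_* − 1` on `L(B)`, `B` cofinitely generated -/

section Cokernel

variable {p : ℕ} [Fact p.Prime] {B : Type} [AddCommGroup B] [Module ℤ_[p] B]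

/-- **`L(B) ⧸ E_B(L(B))` is FINITE** for `B` `p`-primary cofinitely generated and `c ≠ 0` (notation of
`finite_isTorsion_charIdeal_characterModule_ker_shiftedEndo_of_moduleFinite`; the basis `b` of `Y` only
fixes the adjoint `Lt`'s matrix and may be any basis): `E` is onto on `L(B_div)` (cofree part,
`det N ≠ 0` automatic) and has finite cokernel on `L(B ⧸ B_div)` (finite part, `c ≠ 0`) — the tree's
`finite_quotient_range_shiftedEndo_of_exact` on `0 → B_div → B → B ⧸ B_div → 0`. This is the
finiteness of `H¹(D_w/I_w, M^{I_w}) = M^{I_w}/(φ − 1)` ("`|B_v/(γ − 1)B_v| ≤ [B_v : (B_v)_div]`") in the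
co-induced model.
[cite: GreenbergLNM1716, §3, proof of Lemma 3.3 ((γ_{v_n} − 1)B_v ⊇ (B_v)_div, |ker r_{v_n}| ≤ |B_v/(B_v)_div|)]
[cite: GreenbergVatsal2000, proof of Prop. 2.4 (arXiv p. 22)] -/
theorem finite_quotient_range_shiftedEndo_of_moduleFinite
    (hB : ∀ b : B, ∃ k : ℕ, p ^ k • b = 0) [Module.Finite ℤ_[p] (CharacterModule B)]
    (F_B : B →ₗ[ℤ_[p]] B)
    (Lt : (CharacterModule B ⧸ Submodule.torsion ℤ_[p] (CharacterModule B)) →ₗ[ℤ_[p]]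
      (CharacterModule B ⧸ Submodule.torsion ℤ_[p] (CharacterModule B)))
    (hLt : ∀ χ : CharacterModule B,
      Lt (Submodule.Quotient.mk χ) = Submodule.Quotient.mk (CharacterModule.dual F_B χ))
    {c : ℤ_[p]} (hc : c ≠ 0)
    (E_B : BigRepModule ℤ_[p] p B →ₗ[PowerSeries ℤ_[p]] BigRepModule ℤ_[p] p B)
    (hE_B : ∀ Φ, E_B Φ = translate c (mapRange F_B Φ) - Φ) :
    Finite (BigRepModule ℤ_[p] p B ⧸ LinearMap.range E_B) := by
  classical
  obtain ⟨D, tD, hFD, hQ, hY, hDprim, htD⟩ := exists_divisiblePart_data hB F_B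
  haveI := hQ
  set b := Module.finBasis ℤ_[p] (CharacterModule B ⧸ Submodule.torsion ℤ_[p] (CharacterModule B))
    with hb
  have hLt' : ∀ (y : CharacterModule B ⧸ Submodule.torsion ℤ_[p] (CharacterModule B)) (d : D),
      tD (Lt y) d = tD y (F_B.restrict hFD d) := by
    intro y d
    obtain ⟨χ, rfl⟩ := Submodule.Quotient.mk_surjective _ y
    rw [hLt, htD, htD]
    rfl
  exact finite_quotient_range_shiftedEndo_of_exact hDprim hB (Q := B ⧸ D) D.subtype
    D.injective_subtype D.mkQ (Submodule.mkQ_surjective D) (LinearMap.exact_subtype_mkQ D) hY b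
    (F_B.restrict hFD) F_B (D.mapQ D F_B fun x hx => hFD x hx) (LinearMap.ext fun _ => rfl)
    (Submodule.mapQ_mkQ _ _ _).symm Lt hLt' hc E_B hE_B
    (det_shiftedMatrix_ne_zero algebraMap_padicInt_self_injective b Lt hc)

end Cokernel

/-! ## §5 The characteristic polynomial of `Lt` read on ANY free dual datum (cofree `B`) -/

section DualDatum

variable {p : ℕ} [Fact p.Prime] {B : Type} [AddCommGroup B] [Module ℤ_[p] B]
  {Y₀ : Type} [AddCommGroup Y₀] [Module ℤ_[p] Y₀] {tD₀ : Y₀ →+ (B →+ AddCircle (1 : ℚ))}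

/-- A `ℤ_p`-module with a finitely generated Pontryagin dual datum `(Y₀, tD₀)` has finitely
generated character module (the two duals are isomorphic, tree `IsDualPairing.linearEquiv`).
[cite: GreenbergVatsal2000, proof of Prop. 2.4 ff. (arXiv p. 23: the Pontryagin dual of a divisible module is torsion-free, finitely generated, hence free)] -/
theorem module_finite_characterModule_of_isDualPairing (hY₀ : IsDualPairing ℤ_[p] B tD₀)
    [Module.Finite ℤ_[p] Y₀] : Module.Finite ℤ_[p] (CharacterModule B) :=
  Module.Finite.equiv (hY₀.linearEquiv (isDualPairing_characterModule ℤ_[p] B))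

/-- **A COFREE module has torsion-free character module**: if `B` has a free dual datum
`(Y₀, tD₀)` then `(B^∨)_tors = 0`.
[cite: GreenbergVatsal2000, proof of Prop. 2.4 ff. (arXiv p. 23: dual of a divisible module is torsion-free)] -/
theorem torsion_characterModule_eq_bot_of_isDualPairing (hY₀ : IsDualPairing ℤ_[p] B tD₀)
    [Module.Free ℤ_[p] Y₀] : Submodule.torsion ℤ_[p] (CharacterModule B) = ⊥ := by
  set e := hY₀.linearEquiv (isDualPairing_characterModule ℤ_[p] B) with he
  rw [Submodule.eq_bot_iff]
  intro χ hχ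
  obtain ⟨a, ha⟩ := (Submodule.mem_torsion_iff χ).1 hχ
  have ha' : (a : ℤ_[p]) • e.symm χ = 0 := by
    rw [← LinearEquiv.map_smul]
    change e.symm (a • χ) = 0
    rw [ha, map_zero]
  have hy : e.symm χ = 0 := (smul_eq_zero_iff_right (nonZeroDivisors.coe_ne_zero a)).1 ha'
  simpa using congrArg e hy

/-- **The characteristic polynomial of `Lt` is read on any free dual datum.** For a COFREE `B`
with free finitely generated dual datum `(Y₀, tD₀)` (`Greenberg2016.IsDualPairing`), an
endomorphism `F_B` of `B` with an adjoint `Lt₀` on `Y₀` (`tD₀ (Lt₀ y) b = tD₀ y (F_B b)`), and `Lt`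
the endomorphism of `B^∨ ⧸ (B^∨)_tors` induced by `F_B^∨` (§3): `charpoly Lt = charpoly Lt₀` — the
two duals are isomorphic compatibly with the pairings (`IsDualPairing.linearEquiv`,
`toDual_linearEquiv`), `(B^∨)_tors = 0`, and the isomorphism conjugates `Lt₀` into `Lt`
(Mathlib `LinearEquiv.charpoly_conj`). So `P(X) = det(1 − X·Frob)` may be computed on whatever
lattice the arithmetic supplies (e.g. a Tate-module dual of `E[p^∞]`).
[cite: GreenbergVatsal2000, Prop. 2.4 (arXiv p. 22: P_ℓ(X) = det((1 − Frob_ℓ X)|(V_p)_{I_ℓ}) computed on the lattice)] -/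
theorem charpoly_quotientTorsion_endo_dual_eq_of_isDualPairing [Module.Free ℤ_[p] Y₀]
    [Module.Finite ℤ_[p] Y₀] (hY₀ : IsDualPairing ℤ_[p] B tD₀) [Module.Finite ℤ_[p] (CharacterModule B)]
    (F_B : B →ₗ[ℤ_[p]] B) (Lt₀ : Y₀ →ₗ[ℤ_[p]] Y₀)
    (hLt₀ : ∀ (y : Y₀) (b : B), tD₀ (Lt₀ y) b = tD₀ y (F_B b))
    (Lt : (CharacterModule B ⧸ Submodule.torsion ℤ_[p] (CharacterModule B)) →ₗ[ℤ_[p]]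
      (CharacterModule B ⧸ Submodule.torsion ℤ_[p] (CharacterModule B)))
    (hLt : ∀ χ : CharacterModule B,
      Lt (Submodule.Quotient.mk χ) = Submodule.Quotient.mk (CharacterModule.dual F_B χ)) :
    LinearMap.charpoly Lt = LinearMap.charpoly Lt₀ := by
  classical
  set e₀ := hY₀.linearEquiv (isDualPairing_characterModule ℤ_[p] B) with he₀
  have htors := torsion_characterModule_eq_bot_of_isDualPairing hY₀
  set q := (Submodule.torsion ℤ_[p] (CharacterModule B)).quotEquivOfEqBot htors with hq
  set e : Y₀ ≃ₗ[ℤ_[p]] (CharacterModule B ⧸ Submodule.torsion ℤ_[p] (CharacterModule B)) :=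
    e₀.trans q.symm with he
  -- `e₀` intertwines `Lt₀` with `F_B^∨`
  have he₀F : ∀ y : Y₀, e₀ (Lt₀ y) = CharacterModule.dual F_B (e₀ y) := by
    intro y
    have h1 : e₀ (Lt₀ y) = tD₀ (Lt₀ y) :=
      hY₀.toDual_linearEquiv (isDualPairing_characterModule ℤ_[p] B) (Lt₀ y)
    have h2 : e₀ y = tD₀ y := hY₀.toDual_linearEquiv (isDualPairing_characterModule ℤ_[p] B) y
    apply CharacterModule.ext
    intro b
    change (e₀ (Lt₀ y)) b = (e₀ y) (F_B b)
    rw [h1, h2]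
    exact hLt₀ y b
  have hconj : e.conj Lt₀ = Lt := by
    apply LinearMap.ext
    intro y'
    obtain ⟨y, rfl⟩ := e.surjective y'
    rw [LinearEquiv.conj_apply, LinearMap.comp_apply, LinearMap.comp_apply, LinearEquiv.coe_coe,
      LinearEquiv.coe_coe, e.symm_apply_apply]
    change q.symm (e₀ (Lt₀ y)) = Lt (q.symm (e₀ y))
    rw [hq, Submodule.quotEquivOfEqBot_symm_apply, Submodule.quotEquivOfEqBot_symm_apply, hLt, he₀F]
  rw [← hconj, LinearEquiv.charpoly_conj]

/-- **[GreenbergVatsal2000] Prop. 2.4 on the co-induced model, COFREE coefficients, basis-free and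
read on any lattice.** For `B` `p`-primary with a free finitely generated dual datum `(Y₀, tD₀)`,
`F_B : B → B` with adjoint `Lt₀` on `Y₀`, `c ≠ 0`, and any `Λ`-linear `E_B` with
`E_B Φ = τ_c (F_{B*} Φ) − Φ`: `(ker E_B)^∨` is a finitely generated torsion `Λ`-module with
**`Ch_Λ((ker E_B)^∨) = ((charpoly Lt₀).reverse((1+T)^c))`** — no determinant, basis or
non-vanishing hypothesis left. [cite: GreenbergVatsal2000, Prop. 2.4 and proof (arXiv pp. 21–23)] -/
theorem finite_isTorsion_charIdeal_characterModule_ker_shiftedEndo_of_isDualPairing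
    (hB : ∀ b : B, ∃ k : ℕ, p ^ k • b = 0) [Module.Free ℤ_[p] Y₀] [Module.Finite ℤ_[p] Y₀]
    (hY₀ : IsDualPairing ℤ_[p] B tD₀) (F_B : B →ₗ[ℤ_[p]] B) (Lt₀ : Y₀ →ₗ[ℤ_[p]] Y₀)
    (hLt₀ : ∀ (y : Y₀) (b : B), tD₀ (Lt₀ y) b = tD₀ y (F_B b)) {c : ℤ_[p]} (hc : c ≠ 0)
    (E_B : BigRepModule ℤ_[p] p B →ₗ[PowerSeries ℤ_[p]] BigRepModule ℤ_[p] p B)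
    (hE_B : ∀ Φ, E_B Φ = translate c (mapRange F_B Φ) - Φ) :
    Module.Finite (PowerSeries ℤ_[p]) (CharacterModule (LinearMap.ker E_B)) ∧
      Module.IsTorsion (PowerSeries ℤ_[p]) (CharacterModule (LinearMap.ker E_B)) ∧
        Module.charIdeal (PowerSeries ℤ_[p]) (CharacterModule (LinearMap.ker E_B)) =
          Ideal.span {Polynomial.aeval (binomSeries ℤ_[p] c) (LinearMap.charpoly Lt₀).reverse} := by
  haveI := module_finite_characterModule_of_isDualPairing hY₀
  obtain ⟨Lt, hLt⟩ := exists_quotientTorsion_endo_dual F_B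
  rw [← charpoly_quotientTorsion_endo_dual_eq_of_isDualPairing hY₀ F_B Lt₀ hLt₀ Lt hLt]
  exact finite_isTorsion_charIdeal_characterModule_ker_shiftedEndo_eq_span_aeval hB F_B Lt hLt hc E_B
    hE_B

/-- Membership form: `(charpoly Lt₀).reverse((1+T)^c) ∈ Ch_Λ((ker E_B)^∨)` for any free dual datum.
[cite: GreenbergVatsal2000, Prop. 2.4 (arXiv p. 22)] -/
theorem aeval_reverse_charpoly_mem_charIdeal_characterModule_ker_shiftedEndo_of_isDualPairing
    (hB : ∀ b : B, ∃ k : ℕ, p ^ k • b = 0) [Module.Free ℤ_[p] Y₀] [Module.Finite ℤ_[p] Y₀]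
    (hY₀ : IsDualPairing ℤ_[p] B tD₀) (F_B : B →ₗ[ℤ_[p]] B) (Lt₀ : Y₀ →ₗ[ℤ_[p]] Y₀)
    (hLt₀ : ∀ (y : Y₀) (b : B), tD₀ (Lt₀ y) b = tD₀ y (F_B b)) {c : ℤ_[p]} (hc : c ≠ 0)
    (E_B : BigRepModule ℤ_[p] p B →ₗ[PowerSeries ℤ_[p]] BigRepModule ℤ_[p] p B)
    (hE_B : ∀ Φ, E_B Φ = translate c (mapRange F_B Φ) - Φ) :
    Polynomial.aeval (binomSeries ℤ_[p] c) (LinearMap.charpoly Lt₀).reverse ∈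
      Module.charIdeal (PowerSeries ℤ_[p]) (CharacterModule (LinearMap.ker E_B)) := by
  rw [(finite_isTorsion_charIdeal_characterModule_ker_shiftedEndo_of_isDualPairing hB hY₀ F_B Lt₀ hLt₀
    hc E_B hE_B).2.2]
  exact Ideal.mem_span_singleton_self _

/-- Cokernel form on a free dual datum: `L(B) ⧸ E_B(L(B))` is finite (`B` cofree, `c ≠ 0`).
[cite: GreenbergVatsal2000, proof of Prop. 2.4 (arXiv p. 22)] -/
theorem finite_quotient_range_shiftedEndo_of_isDualPairing
    (hB : ∀ b : B, ∃ k : ℕ, p ^ k • b = 0) [Module.Finite ℤ_[p] Y₀]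
    (hY₀ : IsDualPairing ℤ_[p] B tD₀) (F_B : B →ₗ[ℤ_[p]] B) {c : ℤ_[p]} (hc : c ≠ 0)
    (E_B : BigRepModule ℤ_[p] p B →ₗ[PowerSeries ℤ_[p]] BigRepModule ℤ_[p] p B)
    (hE_B : ∀ Φ, E_B Φ = translate c (mapRange F_B Φ) - Φ) :
    Finite (BigRepModule ℤ_[p] p B ⧸ LinearMap.range E_B) := by
  haveI := module_finite_characterModule_of_isDualPairing hY₀
  obtain ⟨Lt, hLt⟩ := exists_quotientTorsion_endo_dual F_B
  exact finite_quotient_range_shiftedEndo_of_moduleFinite hB F_B Lt hLt hc E_B hE_B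

end DualDatum

end Literature.NumberTheory.EllipticCurves.BigRepModule
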